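import Mathlib
import Summits.AtomisticToContinuum.HydrodynamicLimit.Theorems.InformationPercolationEngineKickFairRelEquilibriumMesoKineticWindowCutDefs
import Summits.AtomisticToContinuum.HydrodynamicLimit.Theorems.InformationPercolationEngineKickFairRelEquilibriumMesoReductionB2
import Summits.AtomisticToContinuum.HydrodynamicLimit.Theorems.InformationPercolationEngineKickFairRelEquilibriumMesoPairExpansion2
import HarnessLib

/-!
# `KickFairRelEquilibriumMeso`, ALT line `kinetic-window-cut` — the window cut: SW ∧ CP ⟹ TF

Prover file (`--supports stmt-AtomisticToContinuum-15177`, wave 4, lead c7) for the registered sub-goal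
`truncatedFluctuation_of_window : SameWindowPairCov rs → ClosePairCount rs → TruncatedFluctuation rs` of the alternative line
`kinetic-window-cut` (strategist s1) of the crux `…Theses.InformationPercolationEngine.KickFairRelEquilibriumMeso`.
It is the landed Red-B″ (`truncatedFluctuation_of_pairCondCov`, `…MesoReductionB2`) re-cut by KINETIC WINDOWS of length `tN N`:
the weighted centred family sum `S = Σ_k w_k ξ_k` over `Fin (N+1) × Fin (idxCut A N)` is `Σ_v T_v` (kicks binned by
`⌊t_k/t_N⌋₊ ≤ ⌊τ/t_N⌋₊`, `sum_winWt`); `∫|S| ≤ Σ_v ∫|T_v|`, `(Σ_v ∫|T_v|)² ≤ W Σ_v ∫T_v²` with `W = ⌊τ/t_N⌋₊ + 1 ≤ (τ+1)(N+1)^{1/3}`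
(`card_windows_le`: the windows are paid by the normalisation of SW / CP); for each window the landed abstract pair expansion on the
join (`stub_pairExpansion2`) with weights `1{window v}·w_k` (`winWt`), validity events `winEv` and, as "order" events, the FAR-pair
events `farEv` (`joinSA`-measurable by `measurableSet_sameWindow` / `measurableSet_cellClose`); summed over `v` (at most one window
fires, `sum_ite_and_eq_le_one`; in a common window "not far" is "close", `winEv_inter_subset_closeEv`) the two pair sums are dominated
a.e. by the SW / CP integrands where the cut is genuine (`windowPairSum_le`), in the `lintegral` currency.
-/

noncomputable section

open MeasureTheory Set Filter Topology
open scoped ENNReal Classical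

namespace Summit.AtomisticToContinuum.HydrodynamicLimit.Theorems.KickFairRelEquilibriumMesoLine

open Literature.Analysis.FluidPDE Literature.MathematicalPhysics.KineticTheory

variable {σ : ℝ} {N : ℕ}

/-- The window indicator read off the typed past: `1{⌊t / tw⌋₊ = v}` (`t` = coordinate `.2.2.2`). [folklore] -/
def winFun (tw : ℝ) (v : ℕ) (p : Past N) : ℝ := if ⌊p.2.2.2 / tw⌋₊ = v then 1 else 0

/-- The window-`v` weight of the collision `(i, n)` (the `w k` of `PairExpansion2` in window `v`): `1{⌊t_{i,n}/tw⌋₊ = v} · wt`.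
[folklore] -/
def winWt (Φ : Flow σ N) (τ r tw : ℝ) (h : Fin (N + 1) → ℕ → Past N → ℝ) (v : ℕ) (i : Fin (N + 1)) (n : ℕ)
    (z : Phase N) : ℝ :=
  winFun tw v (past Φ r z i n) * wt Φ τ r h i n z

/-- The window-`v` validity event of `(i, n)` (the `v k`): `t_{i,n} ∈ (0, τ]` and `⌊t_{i,n}/tw⌋₊ = v`. [folklore] -/
def winEv (Φ : Flow σ N) (τ r tw : ℝ) (v : ℕ) (i : Fin (N + 1)) (n : ℕ) : Set (Phase N) :=
  (fun z => past Φ r z i n) ⁻¹' {p : Past N | p.2.2.2 ∈ Set.Ioc 0 τ ∧ ⌊p.2.2.2 / tw⌋₊ = v}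

/-- The far-pair event of `((i,n),(i',n'))` (the `o k l`): `PairFar` of the two typed pasts. [folklore] -/
def farEv (Φ : Flow σ N) (r tw : ℝ) (i : Fin (N + 1)) (n : ℕ) (i' : Fin (N + 1)) (n' : ℕ) : Set (Phase N) :=
  {z | PairFar r tw (past Φ r z i n) (past Φ r z i' n') i i'}

/-- The close-pair event of `((i,n),(i',n'))`: `PairClose` of the two typed pasts. [folklore] -/
def closeEv (Φ : Flow σ N) (r tw : ℝ) (i : Fin (N + 1)) (n : ℕ) (i' : Fin (N + 1)) (n' : ℕ) : Set (Phase N) :=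
  {z | PairClose r tw (past Φ r z i n) (past Φ r z i' n') i i'}

section Hyp

variable (Φ : Flow σ N) (τ r tw : ℝ)

/-- The window indicator is a Borel function of the past. [folklore] -/
theorem measurable_winFun (v : ℕ) : Measurable (winFun (N := N) tw v) := by
  unfold winFun
  exact Measurable.ite ((Nat.measurable_floor.comp ((measurable_snd.comp (measurable_snd.comp
    measurable_snd)).div_const tw)) (measurableSet_singleton v)) measurable_const measurable_const

/-- `w k` is `m k`-measurable (a Borel function of the past of `k`). [folklore] -/
theorem stronglyMeasurable_winWt {h : Fin (N + 1) → ℕ → Past N → ℝ} (hh : ∀ i n, Measurable (h i n)) (v : ℕ)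
    (i : Fin (N + 1)) (n : ℕ) : StronglyMeasurable[pastSA Φ r i n] (winWt Φ τ r tw h v i n) := by
  refine Measurable.stronglyMeasurable ?_
  exact ((measurable_winFun tw v).mul (measurable_wtFun τ hh i n)).comp (comap_measurable _)

/-- `v k` is an `m k`-event. [folklore] -/
theorem measurableSet_winEv (v : ℕ) (i : Fin (N + 1)) (n : ℕ) :
    MeasurableSet[pastSA Φ r i n] (winEv Φ τ r tw v i n) := by
  have ht : Measurable fun p : Past N => p.2.2.2 := measurable_snd.comp (measurable_snd.comp measurable_snd)
  unfold winEv pastSA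
  exact comap_measurable _ ((measurableSet_Ioc.preimage ht).inter
    ((Nat.measurable_floor.comp (ht.div_const tw)) (measurableSet_singleton v)))

/-- `|w k| ≤ 1_{v k}` (`|h| ≤ 1`). [folklore] -/
theorem abs_winWt_le {h : Fin (N + 1) → ℕ → Past N → ℝ} (hhb : ∀ i n p, |h i n p| ≤ 1) (v : ℕ) (i : Fin (N + 1))
    (n : ℕ) (z : Phase N) : |winWt Φ τ r tw h v i n z| ≤ (winEv Φ τ r tw v i n).indicator (fun _ => (1 : ℝ)) z := by
  unfold winWt winFun wt wtFun winEv
  rw [Set.indicator_apply, Set.mem_preimage, Set.mem_setOf_eq]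
  by_cases hz : (past Φ r z i n).2.2.2 ∈ Set.Ioc 0 τ <;> by_cases hv : ⌊(past Φ r z i n).2.2.2 / tw⌋₊ = v <;>
    simp only [hz, hv, if_true, if_false, and_self, and_false, false_and, one_mul, zero_mul, abs_zero, le_refl, hhb]

/-- `o k l` is an `mA k l`-event: `PairFar` is Borel in the pair of pasts. [folklore] -/
theorem measurableSet_farEv_joinSA (i : Fin (N + 1)) (n : ℕ) (i' : Fin (N + 1)) (n' : ℕ) :
    MeasurableSet[joinSA Φ r i n i' n'] (farEv Φ r tw i n i' n') := by
  have h : farEv Φ r tw i n i' n' = (fun z : Phase N => (past Φ r z i n, past Φ r z i' n')) ⁻¹'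
      ({q : Past N × Past N | SameWindow tw q.1 q.2} ∩ {q | CellClose r (q.1.1.1.1 i).1 (q.2.1.1.1 i').1}ᶜ) := rfl
  rw [h]
  exact comap_measurable _ ((measurableSet_sameWindow N tw).inter (measurableSet_cellClose N r i i').compl)

/-- `o l k` is an `mA k l`-event as well (preimage under the swapped pair map). [folklore] -/
theorem measurableSet_farEv_swap_joinSA (i : Fin (N + 1)) (n : ℕ) (i' : Fin (N + 1)) (n' : ℕ) :
    MeasurableSet[joinSA Φ r i n i' n'] (farEv Φ r tw i' n' i n) := by
  have h : farEv Φ r tw i' n' i n = (fun z : Phase N => (past Φ r z i n, past Φ r z i' n')) ⁻¹'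
      ((fun t : Past N × Past N => (t.2, t.1)) ⁻¹'
        ({q : Past N × Past N | SameWindow tw q.1 q.2} ∩ {q | CellClose r (q.1.1.1.1 i').1 (q.2.1.1.1 i).1}ᶜ)) := rfl
  rw [h]
  exact comap_measurable _ ((((measurableSet_sameWindow N tw).inter (measurableSet_cellClose N r i' i).compl)).preimage
    (measurable_snd.prodMk measurable_fst))

/-- The close-pair event is Borel. [folklore] -/
theorem measurableSet_closeEv (i : Fin (N + 1)) (n : ℕ) (i' : Fin (N + 1)) (n' : ℕ) :
    MeasurableSet (closeEv Φ r tw i n i' n') := by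
  have h : closeEv Φ r tw i n i' n' = (fun z : Phase N => (past Φ r z i n, past Φ r z i' n')) ⁻¹'
      ({q : Past N × Past N | SameWindow tw q.1 q.2} ∩ {q | CellClose r (q.1.1.1.1 i).1 (q.2.1.1.1 i').1}) := rfl
  rw [h]
  exact ((measurableSet_sameWindow N tw).inter (measurableSet_cellClose N r i i')).preimage
    (measurable_pastJoin Φ r i n i' n')

/-- Inside a common window "not far" is "close": `v^v_k ∩ v^v_l ∩ (far k l)ᶜ ∩ (far l k)ᶜ ⊆ v^v_k ∩ v^v_l ∩ close k l`
(two valid times with the same `ℕ`-window index have the same `ℤ`-window index). [folklore] -/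
theorem winEv_inter_subset_closeEv {τ tw : ℝ} (htw : 0 < tw) (v : ℕ) (i : Fin (N + 1)) (n : ℕ) (i' : Fin (N + 1))
    (n' : ℕ) :
    winEv Φ τ r tw v i n ∩ winEv Φ τ r tw v i' n' ∩ (farEv Φ r tw i n i' n')ᶜ ∩ (farEv Φ r tw i' n' i n)ᶜ ⊆
      winEv Φ τ r tw v i n ∩ winEv Φ τ r tw v i' n' ∩ closeEv Φ r tw i n i' n' := by
  rintro z ⟨⟨⟨hk, hl⟩, hf⟩, -⟩
  simp only [winEv, Set.mem_preimage, Set.mem_setOf_eq] at hk hl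
  have hs : SameWindow tw (past Φ r z i n) (past Φ r z i' n') := by
    unfold SameWindow
    rw [← Int.natCast_floor_eq_floor (div_pos hk.1.1 htw).le, ← Int.natCast_floor_eq_floor (div_pos hl.1.1 htw).le,
      hk.2, hl.2]
  exact ⟨⟨hk, hl⟩, hs, by_contra fun hc => hf ⟨hs, hc⟩⟩

end Hyp

/-- At most one window fires: `Σ_{v ∈ S} 1{a = v ∧ b = v} ≤ 1`. [folklore] -/
theorem sum_ite_and_eq_le_one (S : Finset ℕ) (a b : ℕ) : ∑ v ∈ S, (if a = v ∧ b = v then (1 : ℝ) else 0) ≤ 1 := by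
  simp_rw [ite_and]
  rw [Finset.sum_ite_eq]
  split_ifs <;> norm_num

/-- **Window decomposition of the weight**: `Σ_{v ≤ ⌊τ/tw⌋₊} 1{⌊t_k/tw⌋₊ = v} w_k = w_k` pointwise (valid times lie in
`(0, τ]`; an invalid collision has weight `0`). [folklore] -/
theorem sum_winWt (Φ : Flow σ N) {τ tw : ℝ} (r : ℝ) (htw : 0 < tw) (h : Fin (N + 1) → ℕ → Past N → ℝ) (i : Fin (N + 1))
    (n : ℕ) (z : Phase N) : ∑ v ∈ Finset.range (⌊τ / tw⌋₊ + 1), winWt Φ τ r tw h v i n z = wt Φ τ r h i n z := by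
  unfold winWt winFun
  rw [← Finset.sum_mul, Finset.sum_ite_eq]
  by_cases ht : (past Φ r z i n).2.2.2 ∈ Set.Ioc 0 τ
  · rw [if_pos (Finset.mem_range.2 (Nat.lt_succ_of_le (Nat.floor_le_floor (div_le_div_of_nonneg_right ht.2 htw.le)))),
      one_mul]
  · have h0 : wt Φ τ r h i n z = 0 := by unfold wt wtFun; rw [if_neg ht, zero_mul]
    rw [h0, mul_zero]

/-- **The windows are paid by the normalisation**: `⌊τ/t_N⌋₊ + 1 ≤ (τ + 1)(N+1)^{1/3}`. [folklore] -/
theorem card_windows_le {τ : ℝ} (hτ : 0 ≤ τ) (N : ℕ) :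
    ((⌊τ / tN N⌋₊ + 1 : ℕ) : ℝ) ≤ (τ + 1) * ((N : ℝ) + 1) ^ (1 / 3 : ℝ) := by
  have hP : 1 ≤ ((N : ℝ) + 1) ^ (1 / 3 : ℝ) := Real.one_le_rpow (by linarith [N.cast_nonneg (α := ℝ)]) (by norm_num)
  have htN : τ / tN N = τ * ((N : ℝ) + 1) ^ (1 / 3 : ℝ) := by rw [tN, Real.rpow_neg (by positivity), div_inv_eq_mul]
  have hfl := Nat.floor_le (mul_nonneg hτ (zero_le_one.trans hP))
  push_cast
  rw [htN]
  nlinarith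

/-- The choice of the SW and CP targets: `(τ+1)(2 δ²/(4(τ+1)) + 16C² δ²/(32C²(τ+1)+1)) ≤ δ²`. [folklore] -/
theorem window_targets_le_sq (C δ : ℝ) {τ : ℝ} (hτ : 0 < τ) :
    (τ + 1) * (2 * (δ ^ 2 / (4 * (τ + 1))) + 4 * (2 * C) ^ 2 * (δ ^ 2 / (32 * C ^ 2 * (τ + 1) + 1))) ≤ δ ^ 2 := by
  have h1 : (τ + 1) * (2 * (δ ^ 2 / (4 * (τ + 1)))) = δ ^ 2 / 2 := by field_simp; ring
  have h2 : (τ + 1) * (4 * (2 * C) ^ 2 * (δ ^ 2 / (32 * C ^ 2 * (τ + 1) + 1))) ≤ δ ^ 2 / 2 := by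
    rw [show (τ + 1) * (4 * (2 * C) ^ 2 * (δ ^ 2 / (32 * C ^ 2 * (τ + 1) + 1))) =
        16 * C ^ 2 * (τ + 1) * δ ^ 2 / (32 * C ^ 2 * (τ + 1) + 1) by ring]
    rw [div_le_div_iff₀ (by positivity) two_pos]
    nlinarith [sq_nonneg δ]
  rw [mul_add]
  linarith

/-- Splitting an event off an indicator: `1_{A ∩ {p}} = 1_A · 1{p}`. [folklore] -/
theorem indicator_inter_setOf {α : Type*} (A : Set α) (p : α → Prop) (x : α) :
    (A ∩ {x | p x}).indicator (fun _ => (1 : ℝ)) x = A.indicator (fun _ => (1 : ℝ)) x * (if p x then 1 else 0) := by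
  by_cases hA : x ∈ A <;> by_cases hp : p x <;> simp [hA, hp]

/-- **Pointwise comparison of the windowed pair sums**: where the cut is genuine, for nonnegative `T`,
`Σ_v Σ_k Σ_l 1_{v^v_k ∩ v^v_l} T_{kl} ≤ Σ_i Σ_{n<cnt_i} Σ_{i'} Σ_{n'<cnt_{i'}} T` (at most one window fires; drop the
truncation). [folklore] -/
theorem windowPairSum_le (Φ : Flow σ N) (τ r tw : ℝ) (W M : ℕ) (T : Fin (N + 1) → ℕ → Fin (N + 1) → ℕ → ℝ)
    (hT : ∀ i n i' n', 0 ≤ T i n i' n') {z : Phase N}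
    (hz : ∀ (i : Fin (N + 1)) (n : ℕ), n < cnt Φ τ z i ↔ (past Φ r z i n).2.2.2 ∈ Set.Ioc 0 τ) :
    ∑ v ∈ Finset.range W, ∑ k : Fin (N + 1) × Fin M, ∑ l : Fin (N + 1) × Fin M,
        (winEv Φ τ r tw v k.1 k.2 ∩ winEv Φ τ r tw v l.1 l.2).indicator (fun _ => (1 : ℝ)) z * T k.1 k.2 l.1 l.2 ≤
      ∑ i, ∑ n ∈ Finset.range (cnt Φ τ z i), ∑ i', ∑ n' ∈ Finset.range (cnt Φ τ z i'), T i n i' n' := by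
  rw [Finset.sum_comm]
  refine le_trans (Finset.sum_le_sum fun k _ => ?_) (sum_prod_fin_cut_le (cnt Φ τ z) M T hT)
  rw [Finset.sum_comm]
  refine Finset.sum_le_sum fun l _ => ?_
  rw [← Finset.sum_mul, ← mul_assoc]
  refine mul_le_mul_of_nonneg_right ?_ (hT _ _ _ _)
  by_cases hk : (past Φ r z k.1 k.2).2.2.2 ∈ Set.Ioc 0 τ <;> by_cases hl : (past Φ r z l.1 l.2).2.2.2 ∈ Set.Ioc 0 τ <;>
    simp only [winEv, Set.indicator_apply, Set.mem_inter_iff, Set.mem_preimage, Set.mem_setOf_eq, hz, hk, hl, true_and,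
      false_and, and_false, if_true, if_false, mul_one, mul_zero, Finset.sum_const_zero, le_refl]
  exact sum_ite_and_eq_le_one _ _ _

/-- **`truncatedFluctuation_of_window` — the kinetic-window cut: SW ∧ CP ⟹ TF.** See the module docstring: window
decomposition of the weighted centred family sum, triangle inequality and Cauchy–Schwarz over the `⌊τ/t_N⌋₊ + 1 ≤ (τ+1)(N+1)^{1/3}`
windows, the abstract pair expansion on the join (`stub_pairExpansion2`) window by window with the far-pair events as order
events, and the pointwise a.e. domination of the summed far / close pair sums by the SW / CP integrands. [folklore] -/
theorem truncatedFluctuation_of_window : SameWindowPairCov rs → ClosePairCount rs → TruncatedFluctuation rs := by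
  intro hSW hCP a₀ θ₀ u₀ ha hθ hu ha0 hθ0
  obtain ⟨σ₁, hσ₁, H1⟩ := hSW a₀ θ₀ u₀ ha hθ hu ha0 hθ0
  obtain ⟨σ₂, hσ₂, H2⟩ := hCP a₀ θ₀ u₀ ha hθ hu ha0 hθ0
  refine ⟨min (min σ₁ σ₂) (1 / 2), lt_min (lt_min hσ₁ hσ₂) (by norm_num), ?_⟩
  intro σ hσ hσlt Φ τ hτ g hg hgb A hA δ hδ
  obtain ⟨C, hC⟩ := hgb
  have hσ1' : σ < σ₁ := hσlt.trans_le ((min_le_left _ _).trans (min_le_left _ _))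
  have hσ2' : σ < σ₂ := hσlt.trans_le ((min_le_left _ _).trans (min_le_right _ _))
  have hσ2 : σ ≤ 1 / 2 := (hσlt.trans_le (min_le_right _ _)).le
  have hC0 : 0 ≤ C := (abs_nonneg _).trans (hC 0)
  -- the targets for SW and CP
  set δ₁ : ℝ := δ ^ 2 / (4 * (τ + 1))
  set δ₂ : ℝ := δ ^ 2 / (32 * C ^ 2 * (τ + 1) + 1)
  have hδ₁0 : 0 < δ₁ := by positivity
  have hδ₂0 : 0 < δ₂ := by positivity
  obtain ⟨N₁, hN₁⟩ := H1 σ hσ hσ1' Φ τ hτ g hg ⟨C, hC⟩ δ₁ hδ₁0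
  obtain ⟨N₂, hN₂⟩ := H2 σ hσ hσ2' Φ τ hτ δ₂ hδ₂0
  refine ⟨max N₁ N₂, fun N hN h hhm hhb => ?_⟩
  have hSWN := hN₁ N (le_of_max_le_left hN)
  have hCPN := hN₂ N (le_of_max_le_right hN)
  set LG := localGibbsLaw σ a₀ u₀ θ₀ N (Φ N)
  haveI : IsProbabilityMeasure LG := isProbabilityMeasure_localGibbsLaw ha hθ hu ha0 hθ0 hσ2 N (Φ N)
  set c : ℝ := hsDiameter σ N / ((N : ℝ) + 1)
  have hc0 : 0 ≤ c := div_nonneg (hsDiameter_pos hσ N).le (by positivity)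
  set M : ℕ := idxCut A N
  set r : ℝ := rs N
  set tw : ℝ := tN N
  have htw0 : 0 < tw := tN_pos N
  set β := fun i n => betaLG σ a₀ θ₀ u₀ (Φ N) r g i n
  set Γ := fun i n i' n' => pairCondCovLG σ a₀ θ₀ u₀ (Φ N) r g i n i' n'
  set D := fun i n => kickDev (Φ N) r g i n
  set w := fun v i n => winWt (Φ N) τ r tw h v i n with hw
  set T : ℕ → Phase N → ℝ := fun v z => ∑ k : Fin (N + 1) × Fin M, w v k.1 k.2 z * (D k.1 k.2 z - β k.1 k.2 z) with hT
  set Sf := fun z => ∑ k : Fin (N + 1) × Fin M, wt (Φ N) τ r h k.1 k.2 z * (D k.1 k.2 z - β k.1 k.2 z) with hSf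
  -- Step 0: the truncated sum is a.e. `c · S` (`truncSum_ae_eq`); reduce to `c ∫ |S| ≤ δ`
  refine (lintegral_congr_ae (g := fun z => ENNReal.ofReal (c * |Sf z|)) ?_).trans_le ?_
  · filter_upwards [truncSum_ae_eq σ N a₀ θ₀ u₀ hσ2 (Φ N) τ r g A h] with z hz
    rw [hz, abs_mul, abs_of_nonneg hc0]
  set P : ℝ := ((N : ℝ) + 1) ^ (1 / 3 : ℝ)
  have hP0 : 0 < P := by positivity
  have haeD := ae_forall_abs_kickDev_le (a₀ := a₀) (θ₀ := θ₀) (u₀ := u₀) hσ2 (Φ N) r hC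
  have haeβ := ae_forall_abs_betaLG_le (a₀ := a₀) (θ₀ := θ₀) (u₀ := u₀) hσ2 (Φ N) r hC
  have haeΓ := ae_forall_abs_pairCondCovLG_le (a₀ := a₀) (θ₀ := θ₀) (u₀ := u₀) hσ2 (Φ N) r hC
  have haecut := ae_forall_lt_cnt_iff_pastTime (a₀ := a₀) (θ₀ := θ₀) (u₀ := u₀) hσ2 (Φ N) τ r
  -- Step 1: the abstract pair expansion PE″ window by window, far pairs as order events
  set X : ℕ → ℝ := fun v => ∑ k : Fin (N + 1) × Fin M, ∑ l : Fin (N + 1) × Fin M,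
      ∫ z, (winEv (Φ N) τ r tw v k.1 k.2 ∩ winEv (Φ N) τ r tw v l.1 l.2 ∩ farEv (Φ N) r tw k.1 k.2 l.1 l.2).indicator
        (fun _ => (1 : ℝ)) z * |Γ k.1 k.2 l.1 l.2 z| ∂LG
  set Y : ℕ → ℝ := fun v => ∑ k : Fin (N + 1) × Fin M, ∑ l : Fin (N + 1) × Fin M,
      LG.real (winEv (Φ N) τ r tw v k.1 k.2 ∩ winEv (Φ N) τ r tw v l.1 l.2 ∩
        (farEv (Φ N) r tw k.1 k.2 l.1 l.2)ᶜ ∩ (farEv (Φ N) r tw l.1 l.2 k.1 k.2)ᶜ)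
  have hPEv : ∀ v, ∫ z, T v z ^ 2 ∂LG ≤ 2 * X v + 4 * (2 * C) ^ 2 * Y v := fun v =>
    stub_pairExpansion2 (Phase N) inferInstance LG (Fin (N + 1) × Fin M)
      (fun k => pastSA (Φ N) r k.1 k.2) (fun k l => joinSA (Φ N) r k.1 k.2 l.1 l.2)
      (fun k => D k.1 k.2) (fun k => w v k.1 k.2) (fun k => winEv (Φ N) τ r tw v k.1 k.2)
      (fun k l => farEv (Φ N) r tw k.1 k.2 l.1 l.2) (2 * C) (by positivity)
      (fun k => pastSA_le (Φ N) r k.1 k.2) (fun k l => joinSA_le (Φ N) r k.1 k.2 l.1 l.2)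
      (fun k l => pastSA_le_joinSA_left (Φ N) r k.1 k.2 l.1 l.2) (fun k l => pastSA_le_joinSA_right (Φ N) r k.1 k.2 l.1 l.2)
      (fun k => integrable_of_ae_abs_le (measurable_kickDev (Φ N) r hg k.1 k.2).aestronglyMeasurable
        (haeD.mono fun z hz => hz k.1 k.2))
      (fun k => haeD.mono fun z hz => hz k.1 k.2)
      (fun k => stronglyMeasurable_winWt (Φ N) τ r tw hhm v k.1 k.2) (fun k => measurableSet_winEv (Φ N) τ r tw v k.1 k.2)
      (fun k z => abs_winWt_le (Φ N) τ r tw hhb v k.1 k.2 z) (fun k l => measurableSet_farEv_joinSA (Φ N) r tw k.1 k.2 l.1 l.2)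
      (fun k l => measurableSet_farEv_swap_joinSA (Φ N) r tw k.1 k.2 l.1 l.2)
  -- Step 2: integrability of the window sums
  have hwm : ∀ v i n, Measurable (w v i n) := fun v i n =>
    ((measurable_winFun tw v).comp (measurable_past (Φ N) r i n)).mul (measurable_wt (Φ N) τ r hhm i n)
  have hw1 : ∀ v i n z, |w v i n z| ≤ 1 := fun v i n z =>
    (abs_winWt_le (Φ N) τ r tw hhb v i n z).trans (Set.indicator_le_self' (fun _ _ => zero_le_one) z)
  have hTm : ∀ v, Measurable (T v) := fun v => Finset.measurable_sum _ fun k _ => (hwm v k.1 k.2).mul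
    ((measurable_kickDev (Φ N) r hg k.1 k.2).sub (measurable_betaLG_borel (Φ N) r g k.1 k.2))
  have hTb : ∀ v, ∀ᵐ z ∂LG, |T v z| ≤ ∑ _k : Fin (N + 1) × Fin M, 4 * C := fun v => by
    filter_upwards [haeD, haeβ] with z hDz hβz
    refine (Finset.abs_sum_le_sum_abs _ _).trans (Finset.sum_le_sum fun k _ => ?_)
    rw [abs_mul]
    exact (mul_le_mul (hw1 v k.1 k.2 z) ((abs_sub _ _).trans (add_le_add (hDz k.1 k.2) (hβz k.1 k.2))) (abs_nonneg _)
      zero_le_one).trans_eq (by ring)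
  have hTi : ∀ v, Integrable (T v) LG := fun v => integrable_of_ae_abs_le (hTm v).aestronglyMeasurable (hTb v)
  have hT2i : ∀ v, Integrable (fun z => T v z ^ 2) LG := fun v =>
    integrable_of_ae_abs_le ((hTm v).pow_const 2).aestronglyMeasurable
      ((hTb v).mono fun z hz => (abs_pow (T v z) 2).trans_le (pow_le_pow_left₀ (abs_nonneg _) hz 2))
  -- Step 3: window decomposition `S = Σ_v T_v`, triangle inequality, Cauchy–Schwarz over the windows
  have hSfeq : ∀ z, Sf z = ∑ v ∈ Finset.range (⌊τ / tw⌋₊ + 1), T v z := fun z => by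
    simp only [hT, hSf, hw]
    rw [Finset.sum_comm]
    exact Finset.sum_congr rfl fun k _ => by rw [← Finset.sum_mul, sum_winWt (Φ N) r htw0]
  have hSfi : Integrable Sf LG :=
    (integrable_finsetSum _ fun v _ => hTi v).congr (ae_of_all _ fun z => (hSfeq z).symm)
  have hI1 : ∫ z, |Sf z| ∂LG ≤ ∑ v ∈ Finset.range (⌊τ / tw⌋₊ + 1), ∫ z, |T v z| ∂LG := by
    rw [← integral_finsetSum _ fun v _ => (hTi v).abs]
    exact integral_mono_of_nonneg (ae_of_all _ fun z => abs_nonneg _) (integrable_finsetSum _ fun v _ => (hTi v).abs)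
      (ae_of_all _ fun z => (congrArg abs (hSfeq z)).trans_le (Finset.abs_sum_le_sum_abs _ _))
  have hI2 : (∑ v ∈ Finset.range (⌊τ / tw⌋₊ + 1), ∫ z, |T v z| ∂LG) ^ 2 ≤
      ((⌊τ / tw⌋₊ + 1 : ℕ) : ℝ) * ∑ v ∈ Finset.range (⌊τ / tw⌋₊ + 1), ∫ z, T v z ^ 2 ∂LG := by
    refine (sq_sum_le_card_mul_sum_sq (s := Finset.range _) (f := fun v => ∫ z, |T v z| ∂LG)).trans ?_
    rw [Finset.card_range]
    exact mul_le_mul_of_nonneg_left (Finset.sum_le_sum fun v _ => sq_integral_abs_le_integral_sq (hTi v) (hT2i v))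
      (Nat.cast_nonneg _)
  have hsum : ∑ v ∈ Finset.range (⌊τ / tw⌋₊ + 1), ∫ z, T v z ^ 2 ∂LG ≤
      2 * ∑ v ∈ Finset.range (⌊τ / tw⌋₊ + 1), X v + 4 * (2 * C) ^ 2 * ∑ v ∈ Finset.range (⌊τ / tw⌋₊ + 1), Y v := by
    rw [Finset.mul_sum, Finset.mul_sum, ← Finset.sum_add_distrib]
    exact Finset.sum_le_sum fun v _ => hPEv v
  -- Step 4: the far pairs, `P c² Σ_v X_v ≤ δ₁` (SW)
  have hVm : ∀ v (k : Fin (N + 1) × Fin M), MeasurableSet (winEv (Φ N) τ r tw v k.1 k.2) := fun v k =>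
    pastSA_le (Φ N) r k.1 k.2 _ (measurableSet_winEv (Φ N) τ r tw v k.1 k.2)
  have hFi : ∀ v (k l : Fin (N + 1) × Fin M), Integrable (fun z =>
      (winEv (Φ N) τ r tw v k.1 k.2 ∩ winEv (Φ N) τ r tw v l.1 l.2 ∩ farEv (Φ N) r tw k.1 k.2 l.1 l.2).indicator
        (fun _ => (1 : ℝ)) z * |Γ k.1 k.2 l.1 l.2 z|) LG := by
    intro v k l
    refine integrable_of_ae_abs_le (((measurable_const.indicator (((hVm v k).inter (hVm v l)).inter (joinSA_le (Φ N) r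
      k.1 k.2 l.1 l.2 _ (measurableSet_farEv_joinSA (Φ N) r tw k.1 k.2 l.1 l.2)))).mul
      (measurable_pairCondCovLG (Φ N) r g k.1 k.2 l.1 l.2).abs).aestronglyMeasurable) (B := 1 * (4 * C) ^ 2) ?_
    filter_upwards [haeΓ] with z h1
    rw [abs_mul, abs_abs, abs_of_nonneg (Set.indicator_nonneg (fun _ _ => zero_le_one) _)]
    exact mul_le_mul (Set.indicator_le_self' (fun _ _ => zero_le_one) z) (h1 k.1 k.2 l.1 l.2) (abs_nonneg _)
      zero_le_one
  have hXb : P * c ^ 2 * ∑ v ∈ Finset.range (⌊τ / tw⌋₊ + 1), X v ≤ δ₁ := by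
    have hEq : P * c ^ 2 * ∑ v ∈ Finset.range (⌊τ / tw⌋₊ + 1), X v = ∫ z, P * c ^ 2 *
        ∑ v ∈ Finset.range (⌊τ / tw⌋₊ + 1), ∑ k : Fin (N + 1) × Fin M, ∑ l : Fin (N + 1) × Fin M,
          (winEv (Φ N) τ r tw v k.1 k.2 ∩ winEv (Φ N) τ r tw v l.1 l.2 ∩ farEv (Φ N) r tw k.1 k.2 l.1 l.2).indicator
            (fun _ => (1 : ℝ)) z * |Γ k.1 k.2 l.1 l.2 z| ∂LG := by
      rw [integral_const_mul, integral_finsetSum _ fun v _ => integrable_finsetSum _ fun k _ =>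
        integrable_finsetSum _ fun l _ => hFi v k l]
      refine congrArg _ (Finset.sum_congr rfl fun v _ => ?_)
      rw [integral_finsetSum _ fun k _ => integrable_finsetSum _ fun l _ => hFi v k l]
      exact Finset.sum_congr rfl fun k _ => (integral_finsetSum _ fun l _ => hFi v k l).symm
    rw [hEq]
    refine integral_le_of_lintegral_ofReal_le (ae_of_all _ fun z => ?_) ((integrable_finsetSum _ fun v _ =>
      integrable_finsetSum _ fun k _ => integrable_finsetSum _ fun l _ => hFi v k l).const_mul _).aestronglyMeasurable
      (haecut.mono fun z hz => ?_) hSWN hδ₁0.le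
    · exact mul_nonneg (by positivity) (Finset.sum_nonneg fun v _ => Finset.sum_nonneg fun k _ =>
        Finset.sum_nonneg fun l _ => mul_nonneg (Set.indicator_nonneg (fun _ _ => zero_le_one) _) (abs_nonneg _))
    · refine mul_le_mul_of_nonneg_left (le_trans (le_of_eq ?_) (windowPairSum_le (Φ N) τ r tw (⌊τ / tw⌋₊ + 1) M
        (fun i n i' n' => (if PairFar r tw (past (Φ N) r z i n) (past (Φ N) r z i' n') i i' then (1 : ℝ) else 0) *
          |Γ i n i' n' z|) (fun _ _ _ _ => by positivity) hz)) (by positivity)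
      refine Finset.sum_congr rfl fun v _ => Fintype.sum_congr _ _ fun k => Fintype.sum_congr _ _ fun l => ?_
      unfold farEv
      rw [indicator_inter_setOf, mul_assoc]
  -- Step 5: the close pairs, `P c² Σ_v Y_v ≤ δ₂` (CP)
  have hGm : ∀ v (k l : Fin (N + 1) × Fin M), MeasurableSet (winEv (Φ N) τ r tw v k.1 k.2 ∩
      winEv (Φ N) τ r tw v l.1 l.2 ∩ closeEv (Φ N) r tw k.1 k.2 l.1 l.2) :=
    fun v k l => ((hVm v k).inter (hVm v l)).inter (measurableSet_closeEv (Φ N) r tw _ _ _ _)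
  have hGi : ∀ v (k l : Fin (N + 1) × Fin M), Integrable (fun z =>
      (winEv (Φ N) τ r tw v k.1 k.2 ∩ winEv (Φ N) τ r tw v l.1 l.2 ∩ closeEv (Φ N) r tw k.1 k.2 l.1 l.2).indicator
        (fun _ => (1 : ℝ)) z) LG := fun v k l => (integrable_const _).indicator (hGm v k l)
  have hYle : ∀ v, Y v ≤ ∑ k : Fin (N + 1) × Fin M, ∑ l : Fin (N + 1) × Fin M,
      ∫ z, (winEv (Φ N) τ r tw v k.1 k.2 ∩ winEv (Φ N) τ r tw v l.1 l.2 ∩ closeEv (Φ N) r tw k.1 k.2 l.1 l.2).indicator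
        (fun _ => (1 : ℝ)) z ∂LG := fun v =>
    Finset.sum_le_sum fun k _ => Finset.sum_le_sum fun l _ => by
      rw [integral_indicator_const _ (hGm v k l), smul_eq_mul, mul_one]
      exact measureReal_mono (winEv_inter_subset_closeEv (Φ N) r htw0 v k.1 k.2 l.1 l.2)
  have hYb : P * c ^ 2 * ∑ v ∈ Finset.range (⌊τ / tw⌋₊ + 1), Y v ≤ δ₂ := by
    have hle : P * c ^ 2 * ∑ v ∈ Finset.range (⌊τ / tw⌋₊ + 1), Y v ≤ ∫ z, P * c ^ 2 *
        ∑ v ∈ Finset.range (⌊τ / tw⌋₊ + 1), ∑ k : Fin (N + 1) × Fin M, ∑ l : Fin (N + 1) × Fin M,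
          (winEv (Φ N) τ r tw v k.1 k.2 ∩ winEv (Φ N) τ r tw v l.1 l.2 ∩ closeEv (Φ N) r tw k.1 k.2 l.1 l.2).indicator
            (fun _ => (1 : ℝ)) z ∂LG := by
      rw [integral_const_mul, integral_finsetSum _ fun v _ => integrable_finsetSum _ fun k _ =>
        integrable_finsetSum _ fun l _ => hGi v k l]
      refine mul_le_mul_of_nonneg_left (Finset.sum_le_sum fun v _ => (hYle v).trans_eq ?_) (by positivity)
      rw [integral_finsetSum _ fun k _ => integrable_finsetSum _ fun l _ => hGi v k l]
      exact Finset.sum_congr rfl fun k _ => (integral_finsetSum _ fun l _ => hGi v k l).symm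
    refine hle.trans (integral_le_of_lintegral_ofReal_le (ae_of_all _ fun z => ?_) ((integrable_finsetSum _ fun v _ =>
      integrable_finsetSum _ fun k _ => integrable_finsetSum _ fun l _ => hGi v k l).const_mul _).aestronglyMeasurable
      (haecut.mono fun z hz => ?_) hCPN hδ₂0.le)
    · exact mul_nonneg (by positivity) (Finset.sum_nonneg fun v _ => Finset.sum_nonneg fun k _ =>
        Finset.sum_nonneg fun l _ => Set.indicator_nonneg (fun _ _ => zero_le_one) _)
    · refine mul_le_mul_of_nonneg_left (le_trans (le_of_eq ?_) (windowPairSum_le (Φ N) τ r tw (⌊τ / tw⌋₊ + 1) M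
        (fun i n i' n' => if PairClose r tw (past (Φ N) r z i n) (past (Φ N) r z i' n') i i' then (1 : ℝ) else 0)
        (fun _ _ _ _ => by positivity) hz)) (by positivity)
      refine Finset.sum_congr rfl fun v _ => Fintype.sum_congr _ _ fun k => Fintype.sum_congr _ _ fun l => ?_
      unfold closeEv
      rw [indicator_inter_setOf]
  -- Step 6: the conclusion `c ∫ |S| ≤ δ`
  have hWle : ((⌊τ / tw⌋₊ + 1 : ℕ) : ℝ) ≤ (τ + 1) * P := card_windows_le hτ.le N
  have hI0 : 0 ≤ ∫ z, |Sf z| ∂LG := integral_nonneg fun z => abs_nonneg _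
  have hmain : c * ∫ z, |Sf z| ∂LG ≤ δ := by
    refine (pow_le_pow_iff_left₀ (mul_nonneg hc0 hI0) hδ.le two_ne_zero).1 ?_
    calc (c * ∫ z, |Sf z| ∂LG) ^ 2 ≤ (c * ∑ v ∈ Finset.range (⌊τ / tw⌋₊ + 1), ∫ z, |T v z| ∂LG) ^ 2 :=
          pow_le_pow_left₀ (mul_nonneg hc0 hI0) (mul_le_mul_of_nonneg_left hI1 hc0) 2
      _ ≤ c ^ 2 * (((⌊τ / tw⌋₊ + 1 : ℕ) : ℝ) * ∑ v ∈ Finset.range (⌊τ / tw⌋₊ + 1), ∫ z, T v z ^ 2 ∂LG) := by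
          rw [mul_pow]; exact mul_le_mul_of_nonneg_left hI2 (sq_nonneg _)
      _ ≤ c ^ 2 * (((τ + 1) * P) * (2 * ∑ v ∈ Finset.range (⌊τ / tw⌋₊ + 1), X v +
            4 * (2 * C) ^ 2 * ∑ v ∈ Finset.range (⌊τ / tw⌋₊ + 1), Y v)) :=
          mul_le_mul_of_nonneg_left (mul_le_mul hWle hsum
            (Finset.sum_nonneg fun v _ => integral_nonneg fun z => sq_nonneg _) (by positivity)) (sq_nonneg _)
      _ = (τ + 1) * (2 * (P * c ^ 2 * ∑ v ∈ Finset.range (⌊τ / tw⌋₊ + 1), X v) +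
            4 * (2 * C) ^ 2 * (P * c ^ 2 * ∑ v ∈ Finset.range (⌊τ / tw⌋₊ + 1), Y v)) := by ring
      _ ≤ (τ + 1) * (2 * δ₁ + 4 * (2 * C) ^ 2 * δ₂) := by gcongr
      _ ≤ δ ^ 2 := window_targets_le_sq C δ hτ
  -- Step 7: back to the `lintegral` statement
  show ∫⁻ z, ENNReal.ofReal (c * |Sf z|) ∂LG ≤ ENNReal.ofReal δ
  rw [← ofReal_integral_eq_lintegral_ofReal (hSfi.abs.const_mul c) (ae_of_all _ fun z => mul_nonneg hc0 (abs_nonneg _))]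
  refine ENNReal.ofReal_le_ofReal ?_
  rw [integral_const_mul]
  exact hmain

end Summit.AtomisticToContinuum.HydrodynamicLimit.Theorems.KickFairRelEquilibriumMesoLine

end
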